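import Mathlib.Algebra.Polynomial.AlgebraMap
import Mathlib.Algebra.Polynomial.Degree.Lemmas
import Mathlib.Algebra.Algebra.Basic
import Mathlib.Analysis.Complex.Basic
import Mathlib.Data.Nat.Factorial.Basic
import Literature.Analysis.Complex.TuranFirstMainTheorem
import HarnessLib

/-!
# Small value estimates at rational translates (Nguyen–Roy 2016) — proofs, III: linear recurrences

Third proofs file towards `Literature.NumberTheory.Transcendental.nguyenRoy2016_thm_1` (Nguyen–Roy,
IJNT 12 (2016) = arXiv:1412.5163). This file sets up the elementary calculus of linear recurrence
sequences used in the proof of **Lemma 7** of the paper (an improvement of Mahler's formula (7) of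
*On a class of entire functions*, Acta Math. Acad. Sci. Hungar. 18 (1967), bounding the coefficients
`A_{μ,ν}` of `u_i = ∑_ν ∑_{μ<m_ν} A_{μ,ν} i^{(μ)} α_ν^{i−μ}` by `(a₀/(a₁a₂)) max_{i<M} |u_i|`), which in
turn follows R. Roy, Mathematika 59 (2013), proof of Prop. 3.3. Everything here is PROVED; the
definitions are plumbing (the length `𝓛` of a univariate complex polynomial, the shift operator `τ`
on complex sequences, and the basic sequences `u^{(μ)}(a) = (i^{(μ)} a^{i−μ})_i`).

## Content

* `NguyenRoy.ulen p = ∑ |p_k|` — the length of `p ∈ ℂ[X]`; submultiplicative (`ulen_mul_le`,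
  `ulen_pow_le`, `ulen_prod_le`), `ulen (X − C a) = 1 + |a|`, and the composition bound
  `ulen (p.comp (X + C c)) ≤ ulen p · (1 + |c|)^{deg p}` (`ulen_comp_X_add_C_le`).
* `NguyenRoy.shiftOp` — the shift `τ (x_i)_i = (x_{i+1})_i` as a `ℂ`-linear endomorphism of `ℕ → ℂ`,
  so that `p(τ) = Polynomial.aeval shiftOp p`; `(p(τ) u)_0 = ∑_k p_k u_k` (`aeval_shiftOp_apply_zero`)
  and `|(p(τ) u)_0| ≤ 𝓛(p) · max_{k ≤ deg p} |u_k|` (`norm_aeval_shiftOp_apply_zero_le`).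
* `NguyenRoy.wseq μ a i = i^{(μ)} a^{i−μ}` (falling factorial `i^{(μ)} = i(i−1)⋯(i−μ+1)`,
  `Nat.descFactorial`) with the identities of Nguyen–Roy p. 5 / Roy 2013 (3.6)–(3.7):
  `(τ − a) u^{(μ+1)} = (μ+1) u^{(μ)}`, `(τ − a) u^{(0)} = 0`, hence
  `(τ − a)^k u^{(μ)} = μ^{(k)} u^{(μ−k)}` (`k ≤ μ`), `= 0` (`k > μ`), and
  `((τ − a)^k u^{(μ)})_0 = μ! δ_{k,μ}` (`aeval_X_sub_C_pow_wseq_zero`).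

## References

* [NguyenRoy2016] N. A. V. Nguyen, D. Roy, IJNT 12 (2016) = arXiv:1412.5163, §3, Lemma 7 and its
  proof (the sequences `u^{(μ,ν)}`, the operator `τ`, "`(τ−α_ν)^m u^{(μ,ν)} = μ^{(m)} u^{(μ−m,ν)}`").
* [Roy2013] D. Roy, Mathematika 59 (2013) 333–363 = arXiv:1301.0663, proof of Prop. 3.3,
  (3.6)–(3.7); Lemma 3.2 (the truncated inverse `a(X)` of `∏ (1 − rᵢX)^{eᵢ}` and its length).

## Also here: Roy's Lemma 3.2 (truncated inverse)

* `NguyenRoy.exists_trunc_inverse` — **Roy 2013, Lemma 3.2** in the form used by Nguyen–Roy: for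
  `r : ι → ℂ` (a finite family, repetitions allowed — this is how the exponents `eᵢ` are encoded),
  `1 ≤ R` with `|rᵢ| ≤ R`, and `e₀ ≥ 1`, there is `a ∈ ℂ[X]` of degree `< e₀` with
  `a(X) ∏ᵢ (1 − rᵢ X) ≡ 1 mod X^{e₀}` and `𝓛(a) ≤ C(e₀ − 1 + #ι, e₀ − 1) R^{e₀ − 1}`
  (`= C(E − 1, e₀ − 1) R^{e₀−1}`, `E = e₀ + #ι`). Proof as in Roy: `a` is the truncation of the power
  series `∏ᵢ ∑_j rᵢʲ Xʲ`, whose coefficients are dominated by those of `(∑_j Rʲ Xʲ)^{#ι}`; we reuse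
  the geometric-series bookkeeping of `Literature/Analysis/Complex/TuranFirstMainTheorem.lean`
  (`PowerSum.geomSeries`, `PowerSum.interpPoly`), rescaling by `R`.
-/

noncomputable section

open Polynomial Finset

namespace Literature.NumberTheory.Transcendental

namespace NguyenRoy

/-! ### The length of a univariate complex polynomial -/

/-- The **length** `𝓛(p) = ∑_k |p_k|` of `p ∈ ℂ[X]`. [cite: NguyenRoy2016, §2 (after Lemma 6)] -/
def ulen (p : ℂ[X]) : ℝ := ∑ k ∈ p.support, ‖p.coeff k‖

/-- `𝓛(p) ≥ 0`. [folklore] -/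
theorem ulen_nonneg (p : ℂ[X]) : 0 ≤ ulen p := sum_nonneg fun _ _ => norm_nonneg _

/-- `𝓛(p)` as a sum over any range containing the support. [folklore] -/
theorem ulen_eq_sum_range {p : ℂ[X]} {N : ℕ} (hN : p.natDegree < N) :
    ulen p = ∑ k ∈ range N, ‖p.coeff k‖ := by
  rw [ulen]
  refine Finset.sum_subset (fun k hk => mem_range.mpr
    ((le_natDegree_of_mem_supp k hk).trans_lt hN)) fun k _ hk => ?_
  rw [notMem_support_iff.mp hk, norm_zero]

/-- `𝓛(0) = 0`. [folklore] -/
@[simp] theorem ulen_zero : ulen 0 = 0 := by simp [ulen]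

/-- `𝓛(C c) = |c|`. [folklore] -/
@[simp] theorem ulen_C (c : ℂ) : ulen (C c) = ‖c‖ := by
  classical
  by_cases hc : c = 0
  · simp [hc]
  · rw [ulen, support_C hc, sum_singleton, coeff_C_zero]

/-- `𝓛(1) = 1`. [folklore] -/
@[simp] theorem ulen_one : ulen 1 = 1 := by rw [← C_1, ulen_C, norm_one]

/-- `𝓛(X − a) = 1 + |a|`. [folklore] -/
theorem ulen_X_sub_C (a : ℂ) : ulen (X - C a) = 1 + ‖a‖ := by
  rw [ulen_eq_sum_range (N := 2) (by rw [natDegree_X_sub_C]; exact one_lt_two)]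
  simp [Finset.sum_range_succ, coeff_X, coeff_C]
  ring

/-- `𝓛(X + c) = 1 + |c|`. [folklore] -/
theorem ulen_X_add_C (c : ℂ) : ulen (X + C c) = 1 + ‖c‖ := by
  rw [← sub_neg_eq_add, ← C_neg, ulen_X_sub_C, norm_neg]

/-- `𝓛(p + q) ≤ 𝓛(p) + 𝓛(q)`. [folklore] -/
theorem ulen_add_le (p q : ℂ[X]) : ulen (p + q) ≤ ulen p + ulen q := by
  have hN : (p + q).natDegree < max p.natDegree q.natDegree + 1 :=
    Nat.lt_succ_of_le (natDegree_add_le p q)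
  rw [ulen_eq_sum_range hN, ulen_eq_sum_range (N := max p.natDegree q.natDegree + 1)
    (Nat.lt_succ_of_le (le_max_left _ _)), ulen_eq_sum_range
    (N := max p.natDegree q.natDegree + 1) (Nat.lt_succ_of_le (le_max_right _ _)),
    ← sum_add_distrib]
  exact sum_le_sum fun k _ => by rw [coeff_add]; exact norm_add_le _ _

/-- `𝓛(∑ pᵢ) ≤ ∑ 𝓛(pᵢ)`. [folklore] -/
theorem ulen_sum_le {ι : Type*} (s : Finset ι) (p : ι → ℂ[X]) :
    ulen (∑ i ∈ s, p i) ≤ ∑ i ∈ s, ulen (p i) := by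
  classical
  induction s using Finset.induction_on with
  | empty => simp
  | @insert i s hi ih =>
    rw [sum_insert hi, sum_insert hi]
    exact (ulen_add_le _ _).trans (by linarith)

/-- `𝓛(c • p) = |c| 𝓛(p)`, in the form `𝓛(C c * p) = |c| 𝓛(p)`. [folklore] -/
theorem ulen_C_mul (c : ℂ) (p : ℂ[X]) : ulen (C c * p) = ‖c‖ * ulen p := by
  by_cases hc : c = 0
  · simp [hc]
  have hN : (C c * p).natDegree < p.natDegree + 1 := by
    rw [natDegree_C_mul hc]; exact Nat.lt_succ_self _
  rw [ulen_eq_sum_range hN, ulen_eq_sum_range (Nat.lt_succ_self p.natDegree), mul_sum]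
  exact sum_congr rfl fun k _ => by rw [coeff_C_mul, norm_mul]

/-- Multiplication by `Xⁱ` does not change the length. [folklore] -/
theorem ulen_X_pow_mul (i : ℕ) (q : ℂ[X]) : ulen (X ^ i * q) = ulen q := by
  have hN : (X ^ i * q).natDegree < i + (q.natDegree + 1) := by
    calc (X ^ i * q).natDegree ≤ (X ^ i : ℂ[X]).natDegree + q.natDegree := natDegree_mul_le
      _ = i + q.natDegree := by rw [natDegree_X_pow]
      _ < i + (q.natDegree + 1) := by omega
  rw [ulen_eq_sum_range hN, Finset.sum_range_add, ulen_eq_sum_range (Nat.lt_succ_self _)]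
  have h0 : ∑ k ∈ range i, ‖(X ^ i * q).coeff k‖ = 0 := by
    refine sum_eq_zero fun k hk => ?_
    rw [coeff_X_pow_mul', if_neg (not_le.mpr (mem_range.mp hk)), norm_zero]
  rw [h0, zero_add]
  exact sum_congr rfl fun k _ => by rw [add_comm, coeff_X_pow_mul]

/-- **Submultiplicativity**: `𝓛(pq) ≤ 𝓛(p) 𝓛(q)`. [folklore] -/
theorem ulen_mul_le (p q : ℂ[X]) : ulen (p * q) ≤ ulen p * ulen q := by
  conv_lhs => rw [as_sum_support_C_mul_X_pow p]
  rw [sum_mul]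
  refine (ulen_sum_le _ _).trans ?_
  rw [ulen, sum_mul]
  refine sum_le_sum fun i _ => ?_
  rw [mul_assoc, ulen_C_mul, ulen_X_pow_mul]

/-- `𝓛(pⁿ) ≤ 𝓛(p)ⁿ`. [folklore] -/
theorem ulen_pow_le (p : ℂ[X]) (n : ℕ) : ulen (p ^ n) ≤ ulen p ^ n := by
  induction n with
  | zero => simp
  | succ n ih =>
    rw [pow_succ, pow_succ]
    exact (ulen_mul_le _ _).trans (mul_le_mul_of_nonneg_right ih (ulen_nonneg _))

/-- `𝓛(∏ pᵢ) ≤ ∏ 𝓛(pᵢ)`. [folklore] -/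
theorem ulen_prod_le {ι : Type*} (s : Finset ι) (p : ι → ℂ[X]) :
    ulen (∏ i ∈ s, p i) ≤ ∏ i ∈ s, ulen (p i) := by
  classical
  induction s using Finset.induction_on with
  | empty => simp
  | @insert i s hi ih =>
    rw [prod_insert hi, prod_insert hi]
    exact (ulen_mul_le _ _).trans (mul_le_mul_of_nonneg_left ih (ulen_nonneg _))

/-- **Composition with a translation**: `𝓛(p(X + c)) ≤ 𝓛(p) (1 + |c|)^{deg p}`. [folklore] -/
theorem ulen_comp_X_add_C_le (p : ℂ[X]) (c : ℂ) :
    ulen (p.comp (X + C c)) ≤ ulen p * (1 + ‖c‖) ^ p.natDegree := by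
  rw [comp_eq_sum_left, Polynomial.sum_def]
  refine (ulen_sum_le _ _).trans ?_
  rw [ulen, sum_mul]
  refine sum_le_sum fun i hi => ?_
  rw [ulen_C_mul]
  refine mul_le_mul_of_nonneg_left ?_ (norm_nonneg _)
  calc ulen ((X + C c) ^ i) ≤ ulen (X + C c) ^ i := ulen_pow_le _ _
    _ = (1 + ‖c‖) ^ i := by rw [ulen_X_add_C]
    _ ≤ (1 + ‖c‖) ^ p.natDegree :=
        pow_le_pow_right₀ (le_add_of_nonneg_right (norm_nonneg _)) (le_natDegree_of_mem_supp i hi)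

/-! ### The shift operator and polynomials in it -/

/-- The shift `τ (x_i)_{i ∈ ℕ} = (x_{i+1})_{i ∈ ℕ}` on complex sequences, as a `ℂ`-linear endomorphism.
[cite: NguyenRoy2016, Lemma 7 (proof)] -/
def shiftOp : Module.End ℂ (ℕ → ℂ) where
  toFun u i := u (i + 1)
  map_add' _ _ := rfl
  map_smul' _ _ := rfl

/-- `(τ u)_i = u_{i+1}`. [folklore] -/
@[simp] theorem shiftOp_apply (u : ℕ → ℂ) (i : ℕ) : shiftOp u i = u (i + 1) := rfl

/-- `(τᵏ u)_i = u_{i+k}`. [folklore] -/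
@[simp] theorem shiftOp_pow_apply (k : ℕ) (u : ℕ → ℂ) (i : ℕ) : (shiftOp ^ k) u i = u (i + k) := by
  induction k generalizing u i with
  | zero => simp
  | succ k ih =>
    rw [pow_succ, Module.End.mul_apply, ih (shiftOp u), shiftOp_apply, add_assoc]

/-- `(p(τ) u)_i = ∑_k p_k u_{i+k}`. [cite: NguyenRoy2016, Lemma 7 (proof)] -/
theorem aeval_shiftOp_apply (p : ℂ[X]) (u : ℕ → ℂ) (i : ℕ) :
    aeval shiftOp p u i = ∑ k ∈ range (p.natDegree + 1), p.coeff k * u (i + k) := by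
  rw [aeval_eq_sum_range, LinearMap.sum_apply, Finset.sum_apply]
  exact sum_congr rfl fun k _ => by rw [LinearMap.smul_apply, Pi.smul_apply, shiftOp_pow_apply,
    smul_eq_mul]

/-- `(p(τ) u)_0 = ∑_k p_k u_k`. [cite: NguyenRoy2016, Lemma 7 (proof, "A_{μ,ν} = (b(τ)u)_0")] -/
theorem aeval_shiftOp_apply_zero (p : ℂ[X]) (u : ℕ → ℂ) :
    aeval shiftOp p u 0 = ∑ k ∈ range (p.natDegree + 1), p.coeff k * u k := by
  rw [aeval_shiftOp_apply]
  simp_rw [zero_add]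

/-- **`|(p(τ)u)_0| ≤ 𝓛(p) max_{k ≤ deg p} |u_k|`**: if `|u_k| ≤ B` for `k ≤ deg p` then
`|(p(τ) u)_0| ≤ 𝓛(p) B`. [cite: NguyenRoy2016, Lemma 7 (proof, "|A_{μ,ν}| ≤ 𝓛(b) max |u_i|")] -/
theorem norm_aeval_shiftOp_apply_zero_le (p : ℂ[X]) (u : ℕ → ℂ) {B : ℝ}
    (hB : ∀ k ≤ p.natDegree, ‖u k‖ ≤ B) : ‖aeval shiftOp p u 0‖ ≤ ulen p * B := by
  rw [aeval_shiftOp_apply_zero, ulen_eq_sum_range (Nat.lt_succ_self p.natDegree), sum_mul]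
  refine (norm_sum_le _ _).trans (sum_le_sum fun k hk => ?_)
  rw [norm_mul]
  exact mul_le_mul_of_nonneg_left (hB k (Nat.lt_succ_iff.mp (mem_range.mp hk))) (norm_nonneg _)

/-- `(X − a)(τ) u = τu − a u`. [folklore] -/
theorem aeval_X_sub_C_shiftOp_apply (a : ℂ) (u : ℕ → ℂ) (i : ℕ) :
    aeval shiftOp (X - C a) u i = u (i + 1) - a * u i := by
  simp [Module.algebraMap_end_apply]

/-! ### The basic sequences `u^{(μ)}(a)_i = i^{(μ)} a^{i−μ}` -/

/-- The basic linear recurrence sequences `u^{(μ)}(a) = (i^{(μ)} a^{i−μ})_{i ∈ ℕ}`,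
`i^{(μ)} = i(i−1)⋯(i−μ+1)` the falling factorial (so the term vanishes for `i < μ`, where the
truncated exponent is immaterial). [cite: NguyenRoy2016, Lemma 7 (proof, the sequences u^{(μ,ν)})] -/
def wseq (μ : ℕ) (a : ℂ) : ℕ → ℂ := fun i => (Nat.descFactorial i μ : ℂ) * a ^ (i - μ)

/-- `u^{(μ)}(a)_i = i^{(μ)} a^{i−μ}`. [folklore] -/
theorem wseq_apply (μ : ℕ) (a : ℂ) (i : ℕ) : wseq μ a i = (Nat.descFactorial i μ : ℂ) * a ^ (i - μ) :=
  rfl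

/-- Initial terms: `u^{(μ)}(a)_0 = δ_{μ,0}`. [cite: NguyenRoy2016, Lemma 7 (proof)] -/
theorem wseq_apply_zero (μ : ℕ) (a : ℂ) : wseq μ a 0 = if μ = 0 then 1 else 0 := by
  rcases μ with _ | μ
  · simp [wseq]
  · simp [wseq]

/-- **`(τ − a) u^{(μ+1)} = (μ + 1) u^{(μ)}`** (Nguyen–Roy: "`(τ−α_ν)^m u^{(μ,ν)} = μ^{(m)} u^{(μ−m,ν)}`",
case `m = 1`). [cite: NguyenRoy2016, Lemma 7 (proof)] -/
theorem aeval_X_sub_C_wseq_succ (μ : ℕ) (a : ℂ) :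
    aeval shiftOp (X - C a) (wseq (μ + 1) a) = (μ + 1 : ℂ) • wseq μ a := by
  funext i
  rw [aeval_X_sub_C_shiftOp_apply, Pi.smul_apply, smul_eq_mul, wseq_apply, wseq_apply, wseq_apply,
    Nat.succ_descFactorial_succ, Nat.descFactorial_succ, Nat.add_sub_add_right]
  rcases lt_trichotomy i μ with h | rfl | h
  · rw [Nat.descFactorial_eq_zero_iff_lt.mpr h]
    simp
  · rw [Nat.sub_self]
    push_cast
    ring
  · obtain ⟨k, rfl⟩ := Nat.exists_eq_add_of_lt h
    have e1 : μ + k + 1 - μ = k + 1 := by omega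
    have e2 : μ + k + 1 - (μ + 1) = k := by omega
    rw [e1, e2]
    push_cast
    ring

/-- **`(τ − a) u^{(0)} = 0`**. [cite: NguyenRoy2016, Lemma 7 (proof)] -/
theorem aeval_X_sub_C_wseq_zero (a : ℂ) : aeval shiftOp (X - C a) (wseq 0 a) = 0 := by
  funext i
  rw [aeval_X_sub_C_shiftOp_apply, wseq_apply, wseq_apply]
  simp [pow_succ]
  ring

/-- **`(τ − a)^k u^{(μ)} = μ^{(k)} u^{(μ−k)}` for `k ≤ μ`.** [cite: NguyenRoy2016, Lemma 7 (proof)] -/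
theorem aeval_X_sub_C_pow_wseq_of_le {k μ : ℕ} (hk : k ≤ μ) (a : ℂ) :
    aeval shiftOp ((X - C a) ^ k) (wseq μ a) = (Nat.descFactorial μ k : ℂ) • wseq (μ - k) a := by
  induction k generalizing μ with
  | zero => simp
  | succ k ih =>
    obtain ⟨μ, rfl⟩ : ∃ μ', μ = μ' + 1 := ⟨μ - 1, by omega⟩
    rw [pow_succ, map_mul, Module.End.mul_apply, aeval_X_sub_C_wseq_succ, map_smul,
      ih (by omega), smul_smul, Nat.succ_descFactorial_succ, Nat.add_sub_add_right]
    push_cast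
    ring_nf

/-- **`(τ − a)^k u^{(μ)} = 0` for `k > μ`** (so `(τ − a)^m` annihilates `u^{(μ)}` for `μ < m`).
[cite: NguyenRoy2016, Lemma 7 (proof, "(τ−α_ν)^{m_ν} annihilates u^{(μ,ν)}")] -/
theorem aeval_X_sub_C_pow_wseq_of_lt {k μ : ℕ} (hk : μ < k) (a : ℂ) :
    aeval shiftOp ((X - C a) ^ k) (wseq μ a) = 0 := by
  obtain ⟨j, rfl⟩ := Nat.exists_eq_add_of_lt hk
  rw [show μ + j + 1 = (j + 1) + μ by ring, pow_add, map_mul, Module.End.mul_apply,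
    aeval_X_sub_C_pow_wseq_of_le le_rfl, map_smul, Nat.sub_self, pow_succ, map_mul,
    Module.End.mul_apply, aeval_X_sub_C_wseq_zero, map_zero, smul_zero]

/-- **Initial terms: `((τ − a)^k u^{(μ)})_0 = μ! δ_{k,μ}`.** [cite: NguyenRoy2016, Lemma 7 (proof)] -/
theorem aeval_X_sub_C_pow_wseq_zero (k μ : ℕ) (a : ℂ) :
    aeval shiftOp ((X - C a) ^ k) (wseq μ a) 0 = if k = μ then (μ.factorial : ℂ) else 0 := by
  rcases le_or_gt k μ with h | h
  · rw [aeval_X_sub_C_pow_wseq_of_le h, Pi.smul_apply, smul_eq_mul, wseq_apply_zero]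
    by_cases hk : k = μ
    · subst hk
      simp [Nat.descFactorial_self]
    · have : μ - k ≠ 0 := by omega
      rw [if_neg this, if_neg hk, mul_zero]
  · rw [aeval_X_sub_C_pow_wseq_of_lt h, Pi.zero_apply, if_neg (by omega)]

/-! ### Roy's Lemma 3.2: the truncated inverse of `∏ (1 − rᵢ X)` -/

/-- Sharp coefficient bound for a non-empty product of geometric series with ratios of modulus
`≤ 1`: `|[Xᵃ] ∏_{j ∈ s} ∑_b u_jᵇ Xᵇ| ≤ C(a + #s − 1, #s − 1)`, the coefficient of `(1 − X)^{−#s}`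
(induction on `s`, hockey-stick identity). [cite: Roy2013, Lemma 3.2 (proof)] -/
theorem norm_coeff_prod_geomSeries_le_choose {ι : Type*} [DecidableEq ι] {s : Finset ι}
    (hs : s.Nonempty) (u : ι → ℂ) (hu : ∀ j ∈ s, ‖u j‖ ≤ 1) (a : ℕ) :
    ‖PowerSeries.coeff a (∏ j ∈ s, Literature.Analysis.Complex.PowerSum.geomSeries (u j))‖ ≤
      ((a + s.card - 1).choose (s.card - 1) : ℝ) := by
  induction hs using Finset.Nonempty.cons_induction generalizing a with
  | singleton i =>
    simp only [prod_singleton, card_singleton, Nat.add_sub_cancel, Nat.sub_self, Nat.choose_zero_right,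
      Nat.cast_one, Literature.Analysis.Complex.PowerSum.geomSeries, PowerSeries.coeff_mk, norm_pow]
    exact pow_le_one₀ (norm_nonneg _) (hu i (mem_singleton_self i))
  | cons i s hi hs ih =>
    rw [prod_cons, mul_comm, PowerSeries.coeff_mul, card_cons hi]
    have hui : ‖u i‖ ≤ 1 := hu i (mem_cons_self i s)
    have hus : ∀ j ∈ s, ‖u j‖ ≤ 1 := fun j hj => hu j (mem_cons.mpr (Or.inr hj))
    have hcard : 1 ≤ s.card := card_pos.mpr hs
    calc ‖∑ p ∈ antidiagonal a, PowerSeries.coeff p.1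
            (∏ j ∈ s, Literature.Analysis.Complex.PowerSum.geomSeries (u j)) *
            PowerSeries.coeff p.2 (Literature.Analysis.Complex.PowerSum.geomSeries (u i))‖
        ≤ ∑ p ∈ antidiagonal a, ‖PowerSeries.coeff p.1
            (∏ j ∈ s, Literature.Analysis.Complex.PowerSum.geomSeries (u j)) *
            PowerSeries.coeff p.2 (Literature.Analysis.Complex.PowerSum.geomSeries (u i))‖ :=
          norm_sum_le _ _
      _ ≤ ∑ p ∈ antidiagonal a, ((p.1 + s.card - 1).choose (s.card - 1) : ℝ) := by
          refine sum_le_sum fun p _ => ?_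
          rw [norm_mul]
          have h2 : ‖PowerSeries.coeff p.2
              (Literature.Analysis.Complex.PowerSum.geomSeries (u i))‖ ≤ 1 := by
            simp only [Literature.Analysis.Complex.PowerSum.geomSeries, PowerSeries.coeff_mk, norm_pow]
            exact pow_le_one₀ (norm_nonneg _) hui
          calc _ ≤ ((p.1 + s.card - 1).choose (s.card - 1) : ℝ) * 1 :=
                mul_le_mul (ih hus p.1) h2 (norm_nonneg _) (Nat.cast_nonneg _)
            _ = _ := mul_one _
      _ = ∑ k ∈ range (a + 1), ((k + (s.card - 1)).choose (s.card - 1) : ℝ) := by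
          rw [Finset.Nat.sum_antidiagonal_eq_sum_range_succ_mk]
          refine sum_congr rfl fun k _ => ?_
          congr 2
          omega
      _ = ((a + (s.card + 1) - 1).choose (s.card + 1 - 1) : ℝ) := by
          have h := Nat.sum_range_add_choose a (s.card - 1)
          rw [show s.card - 1 + 1 = s.card from Nat.sub_add_cancel hcard] at h
          rw [show a + (s.card + 1) - 1 = a + (s.card - 1) + 1 by omega,
            show s.card + 1 - 1 = s.card by omega]
          exact_mod_cast h

/-- Coefficients of a composition with `RX`: `[Xᵏ] p(RX) = p_k Rᵏ`. [folklore] -/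
theorem coeff_comp_C_mul_X (p : ℂ[X]) (R : ℂ) (k : ℕ) : (p.comp (C R * X)).coeff k = p.coeff k * R ^ k := by
  rw [comp_eq_sum_left, Polynomial.sum_def, finsetSum_coeff]
  simp_rw [mul_pow, ← C_pow, ← mul_assoc, ← C_mul, coeff_C_mul_X_pow]
  rw [Finset.sum_ite_eq]
  split_ifs with h
  · rfl
  · rw [notMem_support_iff.mp h, zero_mul]

/-- Length of a composition with `RX`, `|R| ≥ 1`: `𝓛(p(RX)) ≤ 𝓛(p) |R|^{deg p}`; more precisely
`𝓛(p(RX)) = ∑ |p_k| |R|ᵏ`. [folklore] -/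
theorem ulen_comp_C_mul_X (p : ℂ[X]) (R : ℂ) (hR : R ≠ 0) :
    ulen (p.comp (C R * X)) = ∑ k ∈ range (p.natDegree + 1), ‖p.coeff k‖ * ‖R‖ ^ k := by
  have hN : (p.comp (C R * X)).natDegree < p.natDegree + 1 := by
    refine Nat.lt_succ_of_le ((natDegree_comp_le).trans ?_)
    rw [natDegree_C_mul_X R hR, mul_one]
  rw [ulen_eq_sum_range hN]
  exact sum_congr rfl fun k _ => by rw [coeff_comp_C_mul_X, norm_mul, norm_pow]

/-- **Roy 2013, Lemma 3.2 (truncated inverse).** Let `r : ι → ℂ` be a finite family (listing a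
ratio `eᵢ` times encodes the exponent `eᵢ` of the paper), `R ≥ 1` a bound for the `|rᵢ|`, and
`e₀ ≥ 1`. Then there is a polynomial `a ∈ ℂ[X]` of degree `< e₀` with
`a(X) ∏ᵢ (1 − rᵢX) ≡ 1 (mod X^{e₀})` and `𝓛(a) ≤ C(e₀ − 1 + #ι, e₀ − 1) · R^{e₀ − 1}`. (Roy: "there
is a unique polynomial `a(X)` of degree `< e₀` such that `a(X) ∏ (1 − rᵢX)^{eᵢ} ≡ 1 mod X^{e₀}`,
and its length satisfies `𝓛(a) ≤ C(E − 1, e₀ − 1) R^{e₀−1}`", `E = e₀ + ∑ eᵢ`; uniqueness is not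
needed and not proved here.) [cite: Roy2013, Lemma 3.2] -/
theorem exists_trunc_inverse {ι : Type*} [Fintype ι] [DecidableEq ι] (r : ι → ℂ) {R : ℝ}
    (hR : 1 ≤ R) (hr : ∀ i, ‖r i‖ ≤ R) {e₀ : ℕ} (he₀ : 1 ≤ e₀) :
    ∃ a : ℂ[X], a.natDegree < e₀ ∧
      (∀ k < e₀, (a * ∏ i, (1 - C (r i) * X)).coeff k = if k = 0 then 1 else 0) ∧
      ulen a ≤ ((e₀ - 1 + Fintype.card ι).choose (e₀ - 1) : ℝ) * R ^ (e₀ - 1) := by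
  obtain ⟨m, rfl⟩ : ∃ m, e₀ = m + 1 := ⟨e₀ - 1, by omega⟩
  simp only [Nat.add_sub_cancel]
  have hR0 : (R : ℂ) ≠ 0 := by exact_mod_cast (zero_lt_one.trans_le hR).ne'
  -- the rescaled ratios `uᵢ = rᵢ / R` have modulus `≤ 1`
  set u : ι → ℂ := fun i => r i / R with hu_def
  have hu : ∀ i ∈ (univ : Finset ι), ‖u i‖ ≤ 1 := fun i _ => by
    rw [hu_def]
    dsimp only
    rw [norm_div, Complex.norm_real, Real.norm_of_nonneg (zero_le_one.trans hR)]
    exact div_le_one_of_le₀ (hr i) (zero_le_one.trans hR)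
  set H : PowerSeries ℂ := ∏ j ∈ (univ : Finset ι),
    Literature.Analysis.Complex.PowerSum.geomSeries (u j) with hH
  -- `a(X) = (trunc_{e₀} H)(RX)`
  refine ⟨(PowerSeries.trunc (m + 1) H : ℂ[X]).comp (C (R : ℂ) * X), ?_, ?_, ?_⟩
  · refine lt_of_le_of_lt ((natDegree_comp_le).trans ?_) (PowerSeries.natDegree_trunc_lt H m)
    rw [natDegree_C_mul_X _ hR0, mul_one]
  · intro k hk
    -- `∏ (1 − rᵢ X) = P(RX)` with `P = ∏ (1 − uᵢ X)`, and `trunc(H) · P ≡ 1`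
    have hP : ∏ i, (1 - C (r i) * X) =
        (Literature.Analysis.Complex.PowerSum.nodePoly univ u).comp (C (R : ℂ) * X) := by
      rw [Literature.Analysis.Complex.PowerSum.nodePoly, Polynomial.prod_comp]
      refine prod_congr rfl fun i _ => ?_
      rw [sub_comp, one_comp, mul_comp, C_comp, X_comp, ← mul_assoc, ← C_mul, hu_def]
      dsimp only
      rw [div_mul_cancel₀ _ hR0]
    rw [hP, ← mul_comp, coeff_comp_C_mul_X, mul_comm (PowerSeries.trunc (m + 1) H : ℂ[X]),
      ← Literature.Analysis.Complex.PowerSum.interpPoly,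
      Literature.Analysis.Complex.PowerSum.coeff_interpPoly_of_le _ _ (Nat.lt_succ_iff.mp hk)]
    split_ifs with h0
    · rw [h0, pow_zero, mul_one]
    · rw [zero_mul]
  · -- `𝓛(a) = ∑_{k<e₀} |H_k| Rᵏ ≤ R^{e₀−1} ∑_{k<e₀} C(k + #ι − 1, #ι − 1)`
    rw [ulen_comp_C_mul_X _ _ hR0, Complex.norm_real, Real.norm_of_nonneg (zero_le_one.trans hR)]
    have hdeg : (PowerSeries.trunc (m + 1) H : ℂ[X]).natDegree + 1 ≤ m + 1 :=
      PowerSeries.natDegree_trunc_lt H m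
    calc ∑ k ∈ range ((PowerSeries.trunc (m + 1) H : ℂ[X]).natDegree + 1),
          ‖(PowerSeries.trunc (m + 1) H : ℂ[X]).coeff k‖ * R ^ k
        ≤ ∑ k ∈ range (m + 1), ‖(PowerSeries.trunc (m + 1) H : ℂ[X]).coeff k‖ * R ^ k :=
          sum_le_sum_of_subset_of_nonneg (range_mono hdeg) fun k _ _ =>
            mul_nonneg (norm_nonneg _) (pow_nonneg (zero_le_one.trans hR) _)
      _ ≤ ∑ k ∈ range (m + 1), ‖PowerSeries.coeff k H‖ * R ^ m := by
          refine sum_le_sum fun k hk => ?_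
          have hkm : k < m + 1 := mem_range.mp hk
          rw [PowerSeries.coeff_trunc, if_pos hkm]
          exact mul_le_mul_of_nonneg_left (pow_le_pow_right₀ hR (Nat.lt_succ_iff.mp hkm))
            (norm_nonneg _)
      _ = (∑ k ∈ range (m + 1), ‖PowerSeries.coeff k H‖) * R ^ m := (sum_mul _ _ _).symm
      _ ≤ ((m + Fintype.card ι).choose m : ℝ) * R ^ m := by
          refine mul_le_mul_of_nonneg_right ?_ (pow_nonneg (zero_le_one.trans hR) _)
          rcases isEmpty_or_nonempty ι with hι | hι
          · -- no factors: `H = 1`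
            have hH1 : H = 1 := by rw [hH, univ_eq_empty, prod_empty]
            rw [hH1, Fintype.card_eq_zero, add_zero, Nat.choose_self, Nat.cast_one, sum_range_succ']
            simp [PowerSeries.coeff_one]
          · have hne : (univ : Finset ι).Nonempty := univ_nonempty
            calc ∑ k ∈ range (m + 1), ‖PowerSeries.coeff k H‖
                ≤ ∑ k ∈ range (m + 1), ((k + (Fintype.card ι - 1)).choose (Fintype.card ι - 1) : ℝ) := by
                  refine sum_le_sum fun k _ => ?_
                  have h := norm_coeff_prod_geomSeries_le_choose hne u hu k
                  rw [card_univ] at h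
                  refine h.trans (le_of_eq ?_)
                  congr 2
                  have : 1 ≤ Fintype.card ι := Fintype.card_pos
                  omega
              _ = ((m + (Fintype.card ι - 1) + 1).choose (Fintype.card ι - 1 + 1) : ℝ) := by
                  exact_mod_cast Nat.sum_range_add_choose m (Fintype.card ι - 1)
              _ = ((m + Fintype.card ι).choose m : ℝ) := by
                  have h1 : 1 ≤ Fintype.card ι := Fintype.card_pos
                  rw [show m + (Fintype.card ι - 1) + 1 = m + Fintype.card ι by omega,
                    show Fintype.card ι - 1 + 1 = Fintype.card ι by omega]
                  exact_mod_cast (Nat.choose_symm_add (a := m) (b := Fintype.card ι)).symm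

end NguyenRoy

end Literature.NumberTheory.Transcendental
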